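import Literature.MathematicalPhysics.QuantumFieldTheory.Balaban1983to89.B6Lemma21Counterexample

/-!
# `Balaban1983to89.B6Eq259C0Bound` — T. Bałaban, *Propagators and renormalization transformations for lattice gauge
# theories. II*, Commun. Math. Phys. **96** (1984) 223–250 [Balaban1984PropagatorsII], p. 233 [PDF 11]: the displayed bound
# of the constant `c₀(α)` next to condition (2.59)

statement-level skeleton of published theorems with citation tags; proofs where landed; nothing here is a claim about the Yang–Mills mass gap

PDF held: `paper:balaban1984-cmp96-propagators-rt-ii` (journal page = PDF page + 222); p. 233 [PDF 11] read AS AN IMAGE on the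
×2 render `run/shared/lean/pub/pub-balaban/b2b-balaban-ref1/pages/1984-cmp96-propagators-rt-II/…-p011-x2.png`.

CITATION HEADER (lean-in-tree rule).  WHAT IS REPRODUCED: lit-balaban SKELETON row **B6.Eq2.59** (the definition of `c₀(α)`
and condition (2.59), p. 233), namely the DISPLAYED CHAIN printed after (2.58):

  *"where s(y) denotes a scaled image of y on unit lattice, and*
  `c₀(α) = Σ_{z∈Z} e^{−αδ₀|z|} < 2(1 − e^{−αδ₀})⁻¹ < 4/(αδ₀)`*."*

Until now the row was `typed-existing`: `…B6.c0` (the definition, verbatim), `…B6.Cond259` ((2.59)), the closed form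
`…B6Lemma21Counterexample.c0_closed` (`c₀ = (1 + e^{−αδ₀})/(1 − e^{−αδ₀})`), and `…B6.SmallRate` — the cell's record
GAPS G-B6-04 (i) that the second printed inequality `2(1 − e^{−t})⁻¹ < 4/t` holds exactly for `t = αδ₀ < 1.5936…`
(harmless: `α < 1` and `δ₀` is a small constant), typed as the hypothesis `αδ₀ < 1.59` and, so far, used nowhere.
THIS FILE proves the chain: the first inequality for every `αδ₀ > 0` (`c0_lt_two_div`), the second on `0 < t ≤ 1.59`
(`two_div_lt_four_div`: convexity of `exp` between `0` and `−1.59` plus the numeric leaf `e^{1.59} > 200/41`, i.e.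
`e^{−1.59} < 1 − 1.59/2`, from seven Taylor terms `Real.sum_le_exp_of_nonneg`), hence the printed chain under the recorded
threshold (`c0_lt_four_div`, hypothesis `B6.SmallRate δ₀ α`) and in the paper's regime `0 < α < 1`, `0 < δ₀ ≤ 1`
(`c0_lt_four_div_of_le_one`).  Unit `lit-balaban-r03` (B6 reader/typer and fold owner, gen 4), PHASE 2 (G.1/G.2(b)), HOME
`run/shared/lean/pub/lit-balaban/`, 2026-08-21.  IMPORTS `…B6Lemma21Counterexample` (for `c0_closed`; it imports `…B6`).
0 sorry, 0 new named facts; nothing of the tree is restated.  HONEST SCOPE: the threshold `1.59` is the cell's recorded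
one (the exact root of `e^{−t} = 1 − t/2` is `1.5936…`); nothing here touches the Lemma 2.1 constant `c₁(α)` (rows
B6.Lem2.1 / GAPS G-B6-01a/b, refuted as printed in `d = 2`).  Value = kernel certificate of a located printed display;
NOT summit progress.
-/

namespace Literature.MathematicalPhysics.QuantumFieldTheory.Balaban1983to89.B6Eq259C0Bound

open Literature.MathematicalPhysics.QuantumFieldTheory.Balaban1983to89.B6Lemma21Counterexample (c0_closed)

/-- **First printed inequality** `c₀(α) < 2(1 − e^{−αδ₀})⁻¹`, for every `αδ₀ > 0` (from the closed form
`(1 + e^{−αδ₀})/(1 − e^{−αδ₀})` and `e^{−αδ₀} < 1`). [cite: Balaban1984PropagatorsII, p.233 (display after (2.58))] -/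
theorem c0_lt_two_div {δ₀ α : ℝ} (h : 0 < α * δ₀) :
    B6.c0 δ₀ α < 2 / (1 - Real.exp (-(α * δ₀))) := by
  rw [c0_closed h]
  have he1 : Real.exp (-(α * δ₀)) < 1 := Real.exp_lt_one_iff.mpr (by linarith)
  have hden : 0 < 1 - Real.exp (-(α * δ₀)) := by linarith
  exact div_lt_div_of_pos_right (by linarith) hden

/-- numeric leaf: `200/41 < e^{1.59}` (seven Taylor terms: `Σ_{i<7} 1.59^i/i! = 4.897… > 4.878…`). [folklore] -/
private theorem exp_159_gt : (200 : ℝ) / 41 < Real.exp (159 / 100) := by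
  have h := Real.sum_le_exp_of_nonneg (show (0 : ℝ) ≤ 159 / 100 by norm_num) 7
  have hs : ∑ i ∈ Finset.range 7, ((159 : ℝ) / 100) ^ i / (Nat.factorial i) =
      1 + 159 / 100 + (159 / 100) ^ 2 / 2 + (159 / 100) ^ 3 / 6 + (159 / 100) ^ 4 / 24 +
        (159 / 100) ^ 5 / 120 + (159 / 100) ^ 6 / 720 := by
    norm_num [Finset.sum_range_succ, Nat.factorial]
  rw [hs] at h
  have hnum : (200 : ℝ) / 41 < 1 + 159 / 100 + (159 / 100) ^ 2 / 2 + (159 / 100) ^ 3 / 6 + (159 / 100) ^ 4 / 24 +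
      (159 / 100) ^ 5 / 120 + (159 / 100) ^ 6 / 720 := by norm_num
  exact hnum.trans_le h

/-- numeric leaf: `e^{−1.59} < 1 − 1.59/2 = 41/200`. [folklore] -/
private theorem exp_neg_159_lt : Real.exp (-(159 / 100 : ℝ)) < 41 / 200 := by
  have h := exp_159_gt
  have hpos : (0 : ℝ) < Real.exp (159 / 100) := Real.exp_pos _
  rw [Real.exp_neg, inv_lt_comm₀ hpos (by norm_num)]
  rw [show ((41 : ℝ) / 200)⁻¹ = 200 / 41 by norm_num]
  exact h

/-- convexity of `exp` between `0` and `−b`: `e^{−t} ≤ (1 − t/b) + (t/b)·e^{−b}` for `0 ≤ t ≤ b`, `0 < b`. [folklore] -/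
private theorem exp_neg_le_chord {t b : ℝ} (hb : 0 < b) (ht0 : 0 ≤ t) (htb : t ≤ b) :
    Real.exp (-t) ≤ (1 - t / b) + (t / b) * Real.exp (-b) := by
  have hconv := convexOn_exp
  have h1 : 0 ≤ 1 - t / b := by
    rw [sub_nonneg, div_le_one hb]; exact htb
  have h2 : 0 ≤ t / b := div_nonneg ht0 hb.le
  have h := hconv.2 (Set.mem_univ (0 : ℝ)) (Set.mem_univ (-b)) h1 h2 (by ring)
  simp only [smul_eq_mul, mul_zero, zero_add, Real.exp_zero, mul_one] at h
  have harg : t / b * -b = -t := by field_simp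
  rw [harg] at h
  exact h

/-- **Second printed inequality** `2(1 − e^{−t})⁻¹ < 4/t` on `0 < t ≤ 1.59` (GAPS G-B6-04 (i): true exactly for
`t < 1.5936…`; the cell's recorded threshold is `1.59`). [cite: Balaban1984PropagatorsII, p.233 (display after (2.58))] -/
theorem two_div_lt_four_div {t : ℝ} (ht0 : 0 < t) (ht : t ≤ 159 / 100) :
    2 / (1 - Real.exp (-t)) < 4 / t := by
  have hb : (0 : ℝ) < 159 / 100 := by norm_num
  have hchord := exp_neg_le_chord hb ht0.le ht
  have hleaf := exp_neg_159_lt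
  -- `1 − e^{−t} ≥ (t/b)(1 − e^{−b}) > (t/b)·(159/200) = t/2`
  have hkey : t / 2 < 1 - Real.exp (-t) := by
    have h1 : (t / (159 / 100)) * (1 - Real.exp (-(159 / 100 : ℝ))) ≤ 1 - Real.exp (-t) := by nlinarith
    have h2 : t / 2 < (t / (159 / 100)) * (1 - Real.exp (-(159 / 100 : ℝ))) := by
      have : t / 2 = (t / (159 / 100)) * (159 / 200) := by ring
      rw [this]
      exact mul_lt_mul_of_pos_left (by linarith) (div_pos ht0 hb)
    linarith
  have hden : 0 < 1 - Real.exp (-t) := by linarith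
  rw [div_lt_div_iff₀ hden ht0]
  linarith

/-- **The printed chain under the recorded threshold**: `αδ₀ > 0` and `B6.SmallRate δ₀ α` (`αδ₀ < 1.59`) give
`c₀(α) < 2(1 − e^{−αδ₀})⁻¹ < 4/(αδ₀)`, in particular `c₀(α) < 4/(αδ₀)`.
[cite: Balaban1984PropagatorsII, p.233 (display after (2.58))] -/
theorem c0_lt_four_div {δ₀ α : ℝ} (h : 0 < α * δ₀) (hs : B6.SmallRate δ₀ α) :
    B6.c0 δ₀ α < 2 / (1 - Real.exp (-(α * δ₀))) ∧ 2 / (1 - Real.exp (-(α * δ₀))) < 4 / (α * δ₀) := by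
  refine ⟨c0_lt_two_div h, two_div_lt_four_div h ?_⟩
  unfold B6.SmallRate at hs
  norm_num at hs ⊢
  linarith

/-- **The paper's regime**: for `0 < α < 1` and `0 < δ₀ ≤ 1` the threshold is met and `c₀(α) < 4/(αδ₀)` as printed.
[cite: Balaban1984PropagatorsII, p.233 (display after (2.58))] -/
theorem c0_lt_four_div_of_le_one {δ₀ α : ℝ} (hα0 : 0 < α) (hα1 : α < 1) (hδ0 : 0 < δ₀) (hδ1 : δ₀ ≤ 1) :
    B6.c0 δ₀ α < 4 / (α * δ₀) := by
  have h : 0 < α * δ₀ := mul_pos hα0 hδ0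
  have hs : B6.SmallRate δ₀ α := by
    unfold B6.SmallRate
    have : α * δ₀ < 1 := by nlinarith
    norm_num
    linarith
  obtain ⟨h1, h2⟩ := c0_lt_four_div h hs
  exact h1.trans h2

end Literature.MathematicalPhysics.QuantumFieldTheory.Balaban1983to89.B6Eq259C0Bound
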